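import Summits.BirchSwinnertonDyer.BirchSwinnertonDyer.Theorems.EisensteinDepletionAtTwoStarOptBNSFOddIsoTwoAdicHelpers
import HarnessLib

/-!
# Line `nsf` v3 on crux `StarOptBNSF` (item stmt-BirchSwinnertonDyer-27047): the registered stub
# `stub_oddIsoTwoAdic` VERBATIM — an odd-degree isogeny preserves the 2-ADIC type bit «ramified at 2»

Lead bsd-rank2-star-p1 GEN 7, on planner p2 GEN 32's skeleton (HOME/p2/g32/nsf/oddIsoTwoAdic_skel.lean,
STUB-PLAN-stub_oddIsoTwoAdic.md), whose core H1 and composition are reproduced here (kernel-checked there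
modulo the four helpers, now tree theorems in `…OddIsoTwoAdicHelpers`).

THE ARGUMENT (level 4, Galois characterisation of the canonical subgroup; no Néron models).  At the place
`v ∣ 2` of a globally minimal `W` good ordinary at `2`, the tree's
`exists_generator_and_inertia_smul_eq_of_not_dvd` (p = 2, k = 2, u = 3) gives a generator `g` of
`ker red_v ∩ E[4]` and an inertia element `σ` with `σ g = 3 g`; `T₀ = 2g` is THE μ₂-point (`ker red_v ∩ E[2]`
is a singleton away from `0`, H1c).  For an odd-degree isogeny `φ`, `d = φ_v g` satisfies `σ d = 3 d`, hence
`φ_v T₀ = 2 d = σ d − d` has reduction `red′(σ d) − red′ d = 0` (inertia does not move reductions, tree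
`localRed_smul_of_mem_absInertia`) — so `φ_v` maps the μ₂-point to the μ₂-point (`helper_localRed_twoTorsion_iff`,
`⇐` by H1c on `W′` and injectivity H1d).  The dictionary H2 (`red_v = 0 ↔ v₂(x) < 0` for rational points)
and the coordinate transport H3 turn this into the registered statement (`oddIsoTwoAdic_of_helpers`).

* `stub_oddIsoTwoAdic` — the registered stub (name + signature verbatim, HOME/p2/g32/line-nsf.lean
  l.139–144): for `φ : W → W′` of odd degree between globally minimal elliptic curves, `W` good ordinary at
  `2`, and the unique rational 2-torsion abscissae `x`, `x′`:
  `TwoTorsionRamifiedAtTwo x ↔ TwoTorsionRamifiedAtTwo x′`.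

With `stub_oddIsoUnique` / `stub_oddIsoArch` (`…StubOddIsoArch`) this closes nsf v2's `stub_oddIsogenyInvariance`
entirely; line `nsf` then rests on `stub_thmAShadow` (research) and `stub_twoPowerWalk`.
HONEST FRAMING: a registered stub of an OPEN crux; `StarOptBNSF` (27047) / `E1M_NSF` (27021) / BSD are NOT
proved by it; nothing here reads an analytic rank.

References: R. Greenberg, LNM 1716 (1999), §2 p. 70, §5 p. 168 [GreenbergLNM1716]; R. Greenberg, V. Vatsal,
Invent. Math. 142 (2000), §2 p. 26 [GreenbergVatsal2000]; J.-P. Serre, *Local Fields*, IV §4 Prop. 17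
[SerreLocalFields1979]; J. H. Silverman, *AEC*, GTM 106 (2009), VII.2.1–2.2 [SilvermanAEC2009].
-/

set_option linter.dupNamespace false
set_option autoImplicit false

noncomputable section

open scoped Classical
open NumberField IsDedekindDomain Field
open Literature.NumberTheory.EllipticCurves Literature.NumberTheory.EllipticCurves.Greenberg1999
open WeierstrassCurve (minimalDiscriminantInt)
open Summit.BirchSwinnertonDyer.Rank1Residual.X2.GreenbergVatsalReductionDatum (localRed)
open Summit.BirchSwinnertonDyer.BirchSwinnertonDyer.Theorems.DepletionAtTwo.OddIsoTwoAdic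

namespace Summit.BirchSwinnertonDyer.BirchSwinnertonDyer.Theorems.DepletionAtTwo.NsfStubs

/-- **H1 (local core; planner p2 GEN 32's composition, kernel-checked from H1c + H1d + the tree).** At the place `v ∣ 2`, for an
odd-degree isogeny of globally minimal curves, both good ordinary at 2, a nonzero 2-torsion local point lies in
`ker red_v` iff its image under `φ_v` lies in `ker red'_v`.  Mechanism (ODDISO-TWOADIC-PLAN steps 1–4): the
generator `g` of `ker red ∩ E[4]` and an inertia element `σ` with `σ g = 3 g`
(`exists_generator_and_inertia_smul_eq_of_not_dvd`, p = 2, k = 2, u = 3); `d := φ_v g` has `σ d = 3 d`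
(`localPointsMap_smul`), inertia does not move reductions (`localRed_smul_of_mem_absInertia`), so
`red' (φ_v (2g)) = red' (σ d − d) = 0`; `⇐` by the singleton H1c on `W'` and injectivity H1d.
[cite: GreenbergVatsal2000, §2 p. 26] [cite: GreenbergLNM1716, §2 p. 70] -/
theorem helper_localRed_twoTorsion_iff (W W' : WeierstrassCurve ℚ) [W.IsElliptic] [W.IsGloballyMinimal]
    [W'.IsElliptic] [W'.IsGloballyMinimal] (φ : WeierstrassCurve.Isogeny W W') (hodd : Odd φ.degree)
    {v : HeightOneSpectrum (𝓞 ℚ)} (hpv : ((2 : ℕ) : 𝓞 ℚ) ∈ v.asIdeal)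
    (hΔ : ¬ (2 : ℤ) ∣ minimalDiscriminantInt W) (hΔ' : ¬ (2 : ℤ) ∣ minimalDiscriminantInt W')
    (hord : ¬ (2 : ℤ) ∣ W.frobeniusTrace 2) (hord' : ¬ (2 : ℤ) ∣ W'.frobeniusTrace 2)
    (P : localPoints W (v.adicCompletion ℚ)) (h2 : P + P = 0) (h0 : P ≠ 0) :
    localRed W 2 hpv hΔ P = 0 ↔
      localRed W' 2 hpv hΔ' (φ.localPointsMap (v.adicCompletion ℚ) P) = 0 := by
  -- level-4 generator of the canonical line and an inertia element acting on it by `3`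
  obtain ⟨g, hgred, hgord, -, -, σ, hσI, hσg⟩ :=
    Summit.BirchSwinnertonDyer.Rank1Residual.GaloisImage.OrdinaryLineInertiaCyclotomic.exists_generator_and_inertia_smul_eq_of_not_dvd
      W 2 hpv hΔ (by exact_mod_cast hord) 2 (u := 3) (by decide)
  have hg4 : addOrderOf g = 4 := by norm_num at hgord; exact hgord
  have h4g : (g + g) + (g + g) = 0 := by
    have h := addOrderOf_nsmul_eq_zero g
    rw [hg4] at h
    calc (g + g) + (g + g) = (4 : ℕ) • g := by abel
      _ = 0 := h
  have hT0ne : g + g ≠ 0 := by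
    intro h
    have h2g : (2 : ℕ) • g = 0 := by rw [two_nsmul]; exact h
    have hdvd : addOrderOf g ∣ 2 := addOrderOf_dvd_of_nsmul_eq_zero h2g
    rw [hg4] at hdvd
    norm_num at hdvd
  have hT0red : localRed W 2 hpv hΔ (g + g) = 0 := by rw [map_add, hgred, add_zero]
  -- the image of the generator and its inertia scalar
  set d := φ.localPointsMap (v.adicCompletion ℚ) g with hd
  have hσd : σ • d = (3 : ℕ) • d := by
    rw [hd, ← WeierstrassCurve.Isogeny.localPointsMap_smul, hσg, map_nsmul]
  have hφT0 : φ.localPointsMap (v.adicCompletion ℚ) (g + g) = d + d := by rw [map_add]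
  have hφT0red : localRed W' 2 hpv hΔ' (φ.localPointsMap (v.adicCompletion ℚ) (g + g)) = 0 := by
    have h1 := Summit.BirchSwinnertonDyer.Rank1Residual.X2.GreenbergVatsalReductionDatum.localRed_smul_of_mem_absInertia
      W' 2 hpv hΔ' hσI d
    rw [hσd, map_nsmul] at h1
    rw [hφT0, map_add]
    have h3 : (3 : ℕ) • localRed W' 2 hpv hΔ' d - localRed W' 2 hpv hΔ' d = 0 := sub_eq_zero.mpr h1
    calc localRed W' 2 hpv hΔ' d + localRed W' 2 hpv hΔ' d
        = (3 : ℕ) • localRed W' 2 hpv hΔ' d - localRed W' 2 hpv hΔ' d := by abel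
      _ = 0 := h3
  constructor
  · intro hP
    have hPT : P = g + g :=
      helper_ker_twoTorsion_singleton W hpv hΔ hord P (g + g) h2 h0 hP h4g hT0ne hT0red
    rw [hPT]
    exact hφT0red
  · intro hP'
    have hφP0 : φ.localPointsMap (v.adicCompletion ℚ) P ≠ 0 := fun h ↦
      h0 (helper_localPointsMap_twoTorsion_injective W W' φ hodd P h2 h)
    have hφP2 : φ.localPointsMap (v.adicCompletion ℚ) P + φ.localPointsMap (v.adicCompletion ℚ) P = 0 := by
      rw [← map_add, h2, map_zero]
    have hφT0ne : φ.localPointsMap (v.adicCompletion ℚ) (g + g) ≠ 0 := fun h ↦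
      hT0ne (helper_localPointsMap_twoTorsion_injective W W' φ hodd (g + g) h4g h)
    have hφT02 : φ.localPointsMap (v.adicCompletion ℚ) (g + g) +
        φ.localPointsMap (v.adicCompletion ℚ) (g + g) = 0 := by
      rw [← map_add, h4g, map_zero]
    have heq : φ.localPointsMap (v.adicCompletion ℚ) P = φ.localPointsMap (v.adicCompletion ℚ) (g + g) :=
      helper_ker_twoTorsion_singleton W' hpv hΔ' hord' _ _ hφP2 hφP0 hP' hφT02 hφT0ne hφT0red
    have hsub : φ.localPointsMap (v.adicCompletion ℚ) (P - (g + g)) = 0 := by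
      rw [map_sub, heq, sub_self]
    have h2sub : (P - (g + g)) + (P - (g + g)) = 0 := by
      calc (P - (g + g)) + (P - (g + g)) = (P + P) - ((g + g) + (g + g)) := by abel
        _ = 0 := by rw [h2, h4g, sub_zero]
    have hz := helper_localPointsMap_twoTorsion_injective W W' φ hodd (P - (g + g)) h2sub hsub
    rw [sub_eq_zero] at hz
    rw [hz]
    exact hT0red

/-- **Composition (planner p2 GEN 32, kernel-checked): the registered statement of `stub_oddIsoTwoAdic` from H1–H3.**
[cite: GreenbergLNM1716, §5 p. 168] -/
theorem oddIsoTwoAdic_of_helpers :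
    ∀ (W W' : WeierstrassCurve ℚ) [W.IsElliptic] [W.IsGloballyMinimal] [W'.IsElliptic] [W'.IsGloballyMinimal]
      (φ : WeierstrassCurve.Isogeny W W'), Odd φ.degree → IsOrdinaryAt W 2 →
      ∀ x x' : ℚ, HasUniqueRationalTwoTorsionX W x → HasUniqueRationalTwoTorsionX W' x' →
        (TwoTorsionRamifiedAtTwo x ↔ TwoTorsionRamifiedAtTwo x') := by
  intro W W' _ _ _ _ φ hodd hord x x' hux hux'
  obtain ⟨v, hpv⟩ := exists_natCast_mem_asIdeal Nat.prime_two
  have hiso : WeierstrassCurve.IsIsogenous W W' := ⟨φ⟩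
  have hord' : IsOrdinaryAt W' 2 :=
    Summit.BirchSwinnertonDyer.BirchSwinnertonDyer.Theorems.IsogenyMuShift.isOrdinaryAt_of_isIsogenous hiso hord
  have hΔ : ¬ (2 : ℤ) ∣ minimalDiscriminantInt W :=
    W.not_dvd_minimalDiscriminantInt_of_hasGoodReductionAtPrime' 2 hord.1
  have hΔ' : ¬ (2 : ℤ) ∣ minimalDiscriminantInt W' :=
    W'.not_dvd_minimalDiscriminantInt_of_hasGoodReductionAtPrime' 2 hord'.1
  have hord2 : ¬ (2 : ℤ) ∣ W.frobeniusTrace 2 := by exact_mod_cast hord.2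
  have hord2' : ¬ (2 : ℤ) ∣ W'.frobeniusTrace 2 := by exact_mod_cast hord'.2
  obtain ⟨T, T', y, y', h, h', hT, hT', hφ, h2, h0⟩ :=
    helper_isogeny_twoTorsion_coords W W' φ hodd x x' hux hux'
  set P : localPoints W (v.adicCompletion ℚ) := pointsMap W (v.adicCompletion ℚ) T with hP
  have hP2 : P + P = 0 := by rw [hP, ← map_add, h2, map_zero]
  have hP0 : P ≠ 0 := by
    intro hz
    apply h0
    have hinj := pointsMapOfEmb_injective W (closureEmb (K := ℚ) (v.adicCompletion ℚ))
    apply hinj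
    change pointsMap W (v.adicCompletion ℚ) T = pointsMap W (v.adicCompletion ℚ) 0
    rw [map_zero]
    exact hz
  have hcore := helper_localRed_twoTorsion_iff W W' φ hodd hpv hΔ hΔ' hord2 hord2' P hP2 hP0
  have hmap : φ.localPointsMap (v.adicCompletion ℚ) P = pointsMap W' (v.adicCompletion ℚ) T' := by
    rw [hP, WeierstrassCurve.Isogeny.localPointsMap_pointsMap, hφ]
  rw [hmap, hP, hT, hT'] at hcore
  rw [← helper_localRed_ratPoint_eq_zero_iff W hpv hΔ x y h,
    ← helper_localRed_ratPoint_eq_zero_iff W' hpv hΔ' x' y' h']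
  exact hcore


/-- **`stub_oddIsoTwoAdic` (line `nsf` v3, registered on stmt-BirchSwinnertonDyer-27047), verbatim.**  An
isogeny of ODD degree between globally minimal elliptic curves over `ℚ`, `W` good ordinary at `2`, preserves
Greenberg's 2-adic type bit «ramified at `2`» (`v₂(x) < 0`: the point lies in the kernel of reduction, the
μ₂-point of the ordinary curve) of the unique rational 2-torsion points. [cite: GreenbergLNM1716, §5 p. 168]
[cite: GreenbergVatsal2000, §2 p. 26] [cite: SilvermanAEC2009, VII.2.1–2.2] -/
theorem stub_oddIsoTwoAdic :
    ∀ (W W' : WeierstrassCurve ℚ) [W.IsElliptic] [W.IsGloballyMinimal] [W'.IsElliptic] [W'.IsGloballyMinimal]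
      (φ : WeierstrassCurve.Isogeny W W'), Odd φ.degree → IsOrdinaryAt W 2 →
      ∀ x x' : ℚ, HasUniqueRationalTwoTorsionX W x → HasUniqueRationalTwoTorsionX W' x' →
        (TwoTorsionRamifiedAtTwo x ↔ TwoTorsionRamifiedAtTwo x') :=
  oddIsoTwoAdic_of_helpers

end Summit.BirchSwinnertonDyer.BirchSwinnertonDyer.Theorems.DepletionAtTwo.NsfStubs

end
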